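import Mathlib
import Literature.MathematicalPhysics.QuantumManyBody.FourierPositiveType

/-!
# Crux `OnePercentCertificate` (stmt-AtomisticToContinuum-11958), line `Sketch`: stub `stub_posType_gaussBernstein`

Bochner in Bernstein coordinates: a signed finite Gaussian mixture minus a Bernstein tail piece,
`r ↦ Σ_m α_m e^{−t_m r²} − κ ∫₀ᵀ u² e^{−u r²} du`, is of positive type on `ℝ³` (all finite quadratic
forms, diagonal included) when its Gaussian symbol dominates:
`κ ∫₀ᵀ √u e^{−s/u} du ≤ Σ_m α_m t_m^{−3/2} e^{−s/t_m}` for all `s ≥ 0`.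

Route (no Bochner theorem, no Fourier inversion): the tree's mechanism
`Coulomb.positiveType_points_nonneg` (`Literature/…/PositiveTypePointCharges.lean`) gives
`0 ≤ Σᵢ Σⱼ wᵢ wⱼ F(yᵢ − yⱼ)` for every kernel `F(z) = ∫ Φ(p) cos(2π⟨p, z⟩) dp` with `Φ ≥ 0`
measurable and integrable (background `g := 0`).  We take the symbol
`Φ(p) = Σ_m α_m/√(t_m)³ · e^{−π²‖p‖²/t_m} − κ ∫₀ᵀ √u · e^{−π²‖p‖²/u} du` (`≥ 0` by the hypothesis
with `s = π²‖p‖²`) and compute `F(z) = π^{−3/2} (Σ_m α_m e^{−t_m‖z‖²} − κ ∫₀ᵀ u² e^{−u‖z‖²} du)`: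
each Gaussian is the real part of Mathlib's `GaussianFourier.integral_cexp_neg_mul_sq_norm_add`
(`∫ e^{−b‖p‖²} cos(2π⟨p, z⟩) dp = (π/b)^{3/2} e^{−π²‖z‖²/b}` on `ℝ³`), and the tail is swapped
by Fubini over `(0, T] × ℝ³` (the integrand is dominated by `√T e^{−π²‖p‖²/T}`).

* `PosTypeGaussBernstein.integral_exp_neg_mul_sq_norm_mul_cos` — the Gaussian cosine transform;
* `PosTypeGaussBernstein.integral_tailKernel_mul_cos` — Fubini for the Bernstein tail;
* `PosTypeGaussBernstein.integral_gaussBernsteinSymbol_mul_cos` — the kernel of the symbol;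
* `stub_posType_gaussBernstein` — the stub.
-/

noncomputable section

namespace Summit.AtomisticToContinuum.Crystallization.Theorems

open MeasureTheory
open scoped BigOperators

local notation "E3" => EuclideanSpace ℝ (Fin 3)

namespace PosTypeGaussBernstein

open Real Set
open scoped InnerProductSpace
open Literature.MathematicalPhysics.QuantumManyBody

/-! ### The Gaussian cosine transform on `ℝ³` -/

/-- Real part of the complex Gaussian with a linear phase:
`Re exp(−b‖p‖² + 2πi⟨z, p⟩) = exp(−b‖p‖²) cos(2π⟨p, z⟩)` for real `b`. -/
theorem re_cexp_neg_mul_sq_norm_add (b : ℝ) (p z : E3) :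
    (Complex.exp (-(b : ℂ) * (‖p‖ : ℂ) ^ 2 + 2 * π * Complex.I * (⟪z, p⟫_ℝ : ℂ))).re =
      Real.exp (-b * ‖p‖ ^ 2) * Real.cos (2 * π * ⟪p, z⟫_ℝ) := by
  rw [Complex.exp_re]
  congr 2
  · simp [Complex.add_re, Complex.mul_re, Complex.mul_im, pow_two]
  · simp [Complex.add_im, Complex.mul_re, Complex.mul_im, pow_two, real_inner_comm]

/-- **Gaussian cosine transform on `ℝ³`**: for `b > 0` and `z ∈ ℝ³`,
`∫ exp(−b‖p‖²) cos(2π⟨p, z⟩) dp = (π/b)^{3/2} exp(−π²‖z‖²/b)` (the real part of Mathlib's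
`GaussianFourier.integral_cexp_neg_mul_sq_norm_add`). -/
theorem integral_exp_neg_mul_sq_norm_mul_cos (b : ℝ) (hb : 0 < b) (z : E3) :
    ∫ p : E3, Real.exp (-b * ‖p‖ ^ 2) * Real.cos (2 * π * ⟪p, z⟫_ℝ) =
      (π / b) ^ (3 / 2 : ℝ) * Real.exp (-π ^ 2 * ‖z‖ ^ 2 / b) := by
  have hb' : 0 < (b : ℂ).re := by simpa using hb
  have hI := GaussianFourier.integrable_cexp_neg_mul_sq_norm_add hb' (2 * π * Complex.I) z
  have hE := GaussianFourier.integral_cexp_neg_mul_sq_norm_add hb' (2 * π * Complex.I) z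
  have h1 : ∫ p : E3, Real.exp (-b * ‖p‖ ^ 2) * Real.cos (2 * π * ⟪p, z⟫_ℝ) =
      (∫ p : E3, Complex.exp (-(b : ℂ) * (‖p‖ : ℂ) ^ 2 +
        2 * π * Complex.I * (⟪z, p⟫_ℝ : ℂ))).re := by
    rw [← RCLike.re_to_complex, ← integral_re hI]
    refine integral_congr_ae (Filter.Eventually.of_forall fun p => ?_)
    simp only [RCLike.re_to_complex]
    exact (re_cexp_neg_mul_sq_norm_add b p z).symm
  rw [h1, hE, finrank_euclideanSpace_fin]
  have h2 : (2 * (π : ℂ) * Complex.I) ^ 2 * (‖z‖ : ℂ) ^ 2 / (4 * (b : ℂ)) =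
      ((-π ^ 2 * ‖z‖ ^ 2 / b : ℝ) : ℂ) := by
    have hb0 : (b : ℂ) ≠ 0 := by exact_mod_cast hb.ne'
    push_cast
    field_simp
    rw [Complex.I_sq]
    ring
  have h3 : ((π : ℂ) / (b : ℂ)) ^ (((3 : ℕ) : ℂ) / 2) = (((π / b) ^ (3 / 2 : ℝ) : ℝ) : ℂ) := by
    rw [Complex.ofReal_cpow (by positivity)]
    push_cast
    norm_num
  rw [h2, h3, ← Complex.ofReal_exp, ← Complex.ofReal_mul, Complex.ofReal_re]

/-- `(t/π)^{3/2} = √t³/√π³` for `t ≥ 0`. -/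
theorem div_pi_rpow_three_halves (t : ℝ) (ht : 0 ≤ t) :
    (t / π) ^ (3 / 2 : ℝ) = Real.sqrt t ^ 3 / Real.sqrt π ^ 3 := by
  rw [Real.rpow_div_two_eq_sqrt 3 (div_nonneg ht pi_pos.le), Real.sqrt_div' t pi_pos.le,
    Real.rpow_ofNat, div_pow]

/-- Gaussian cosine transform in the heat parametrisation: for `t > 0`,
`∫ exp(−π²‖p‖²/t) cos(2π⟨p, z⟩) dp = (√t³/√π³) · exp(−t‖z‖²)`. -/
theorem integral_exp_neg_pi_sq_mul_cos (t : ℝ) (ht : 0 < t) (z : E3) :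
    ∫ p : E3, Real.exp (-(π ^ 2 * ‖p‖ ^ 2) / t) * Real.cos (2 * π * ⟪p, z⟫_ℝ) =
      Real.sqrt t ^ 3 / Real.sqrt π ^ 3 * Real.exp (-t * ‖z‖ ^ 2) := by
  have hb : 0 < π ^ 2 / t := by positivity
  have h := integral_exp_neg_mul_sq_norm_mul_cos (π ^ 2 / t) hb z
  have e1 : ∀ p : E3, -(π ^ 2 / t) * ‖p‖ ^ 2 = -(π ^ 2 * ‖p‖ ^ 2) / t := fun p => by ring
  have e2 : π / (π ^ 2 / t) = t / π := by
    field_simp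
  have e3 : -π ^ 2 * ‖z‖ ^ 2 / (π ^ 2 / t) = -t * ‖z‖ ^ 2 := by
    field_simp
  simp_rw [e1, e2, e3, div_pi_rpow_three_halves t ht.le] at h
  exact h

/-- The Gaussian `p ↦ exp(−b‖p‖²)` is integrable on `ℝ³` for `b > 0`. -/
theorem integrable_exp_neg_mul_sq_norm (b : ℝ) (hb : 0 < b) :
    Integrable fun p : E3 => Real.exp (-b * ‖p‖ ^ 2) := by
  refine Integrable.of_integral_ne_zero ?_
  rw [GaussianFourier.integral_rexp_neg_mul_sq_norm hb]
  exact (Real.rpow_pos_of_pos (by positivity) _).ne'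

/-- Interval integrability of the Bernstein-tail symbol integrand `u ↦ √u · e^{−s/u}` on `[0, T]`
for `s ≥ 0` (it is measurable and bounded by `√T`). -/
theorem intervalIntegrable_sqrt_mul_exp (s T : ℝ) (hs : 0 ≤ s) (hT : 0 ≤ T) :
    IntervalIntegrable (fun u => Real.sqrt u * Real.exp (-s / u)) volume 0 T := by
  rw [intervalIntegrable_iff_integrableOn_Ioc_of_le hT]
  have hc : IntegrableOn (fun _ : ℝ => Real.sqrt T) (Ioc 0 T) volume :=
    integrableOn_const (hs := measure_Ioc_lt_top.ne)
  refine hc.mono' ?_ ?_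
  · exact ((Real.continuous_sqrt.measurable).mul
      (Real.measurable_exp.comp (measurable_const.div measurable_id))).aestronglyMeasurable
  · rw [ae_restrict_iff' measurableSet_Ioc]
    refine Filter.Eventually.of_forall fun u hu => ?_
    rw [Real.norm_of_nonneg (mul_nonneg (Real.sqrt_nonneg _) (Real.exp_pos _).le)]
    calc Real.sqrt u * Real.exp (-s / u) ≤ Real.sqrt T * 1 := by
          refine mul_le_mul (Real.sqrt_le_sqrt hu.2) ?_ (Real.exp_pos _).le (Real.sqrt_nonneg _)
          rw [Real.exp_le_one_iff, neg_div]
          exact neg_nonpos.mpr (div_nonneg hs hu.1.le)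
      _ = Real.sqrt T := mul_one _

/-- `0 ≤ ∫₀ᵀ √u · e^{−s/u} du` for `T ≥ 0`. -/
theorem tailSymbol_nonneg (s T : ℝ) (hT : 0 ≤ T) :
    0 ≤ ∫ u in (0 : ℝ)..T, Real.sqrt u * Real.exp (-s / u) :=
  intervalIntegral.integral_nonneg hT fun _ _ =>
    mul_nonneg (Real.sqrt_nonneg _) (Real.exp_pos _).le

/-- `∫₀ᵀ √u · e^{−s/u} du ≤ T · (√T · e^{−s/T})` for `s ≥ 0`, `T ≥ 0`. -/
theorem tailSymbol_le (s T : ℝ) (hs : 0 ≤ s) (hT : 0 ≤ T) :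
    ∫ u in (0 : ℝ)..T, Real.sqrt u * Real.exp (-s / u) ≤
      T * (Real.sqrt T * Real.exp (-s / T)) := by
  have h := intervalIntegral.integral_mono_on hT (intervalIntegrable_sqrt_mul_exp s T hs hT)
    (intervalIntegrable_const (c := Real.sqrt T * Real.exp (-s / T))) (fun u hu => ?_)
  · rwa [intervalIntegral.integral_const, smul_eq_mul, sub_zero] at h
  · rcases eq_or_lt_of_le hu.1 with h0 | hu0
    · rw [← h0, Real.sqrt_zero, zero_mul]
      exact mul_nonneg (Real.sqrt_nonneg _) (Real.exp_pos _).le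
    · refine mul_le_mul (Real.sqrt_le_sqrt hu.2) ?_ (Real.exp_pos _).le (Real.sqrt_nonneg _)
      rw [Real.exp_le_exp, neg_div, neg_div]
      exact neg_le_neg (div_le_div_of_nonneg_left hs hu0 hu.2)

/-! ### The Bernstein tail: measurability, domination, Fubini -/

/-- The two-variable symbol integrand `(p, u) ↦ √u · exp(−π²‖p‖²/u)` is measurable. -/
theorem measurable_tailIntegrand :
    Measurable fun q : E3 × ℝ => Real.sqrt q.2 * Real.exp (-(π ^ 2 * ‖q.1‖ ^ 2) / q.2) :=
  (Real.continuous_sqrt.measurable.comp measurable_snd).mul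
    (Real.measurable_exp.comp ((measurable_const.mul
      ((measurable_fst.norm).pow_const 2)).neg.div measurable_snd))

/-- The tail kernel `p ↦ ∫₀ᵀ √u · exp(−π²‖p‖²/u) du` is strongly measurable (`T ≥ 0`). -/
theorem stronglyMeasurable_tailKernel (T : ℝ) (hT : 0 ≤ T) :
    StronglyMeasurable fun p : E3 =>
      ∫ u in (0 : ℝ)..T, Real.sqrt u * Real.exp (-(π ^ 2 * ‖p‖ ^ 2) / u) := by
  have e : (fun p : E3 => ∫ u in (0 : ℝ)..T, Real.sqrt u * Real.exp (-(π ^ 2 * ‖p‖ ^ 2) / u)) =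
      fun p : E3 => ∫ u, (fun q : E3 × ℝ => Real.sqrt q.2 * Real.exp (-(π ^ 2 * ‖q.1‖ ^ 2) / q.2))
        (p, u) ∂(volume.restrict (Ioc 0 T)) := by
    funext p
    rw [intervalIntegral.integral_of_le hT]
  rw [e]
  exact measurable_tailIntegrand.stronglyMeasurable.integral_prod_right'

/-- The tail kernel `p ↦ ∫₀ᵀ √u · exp(−π²‖p‖²/u) du` is integrable on `ℝ³` (`T > 0`): it is
nonnegative and dominated by the Gaussian `T√T · exp(−π²‖p‖²/T)`. -/
theorem integrable_tailKernel (T : ℝ) (hT : 0 < T) :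
    Integrable fun p : E3 =>
      ∫ u in (0 : ℝ)..T, Real.sqrt u * Real.exp (-(π ^ 2 * ‖p‖ ^ 2) / u) := by
  have hg : Integrable fun p : E3 => T * Real.sqrt T * Real.exp (-(π ^ 2 / T) * ‖p‖ ^ 2) :=
    (integrable_exp_neg_mul_sq_norm (π ^ 2 / T) (by positivity)).const_mul _
  refine hg.mono' (stronglyMeasurable_tailKernel T hT.le).aestronglyMeasurable
    (Filter.Eventually.of_forall fun p => ?_)
  rw [Real.norm_of_nonneg (tailSymbol_nonneg _ T hT.le)]
  calc ∫ u in (0 : ℝ)..T, Real.sqrt u * Real.exp (-(π ^ 2 * ‖p‖ ^ 2) / u)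
        ≤ T * (Real.sqrt T * Real.exp (-(π ^ 2 * ‖p‖ ^ 2) / T)) :=
          tailSymbol_le (π ^ 2 * ‖p‖ ^ 2) T (by positivity) hT.le
    _ = T * Real.sqrt T * Real.exp (-(π ^ 2 / T) * ‖p‖ ^ 2) := by
          rw [mul_assoc, show -(π ^ 2 / T) * ‖p‖ ^ 2 = -(π ^ 2 * ‖p‖ ^ 2) / T by ring]

/-- Product integrability of `(p, u) ↦ √u · exp(−π²‖p‖²/u) · cos(2π⟨p, z⟩)` on `ℝ³ × (0, T]`
(dominated by `√T · exp(−π²‖p‖²/T)`). -/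
theorem integrable_prod_tailIntegrand_mul_cos (T : ℝ) (hT : 0 < T) (z : E3) :
    Integrable (Function.uncurry fun (p : E3) (u : ℝ) =>
      Real.sqrt u * Real.exp (-(π ^ 2 * ‖p‖ ^ 2) / u) * Real.cos (2 * π * ⟪p, z⟫_ℝ))
      (volume.prod (volume.restrict (Ioc 0 T))) := by
  have hf : Integrable (fun p : E3 => Real.sqrt T * Real.exp (-(π ^ 2 / T) * ‖p‖ ^ 2)) :=
    (integrable_exp_neg_mul_sq_norm (π ^ 2 / T) (by positivity)).const_mul _
  have hg : Integrable (fun _ : ℝ => (1 : ℝ)) (volume.restrict (Ioc 0 T)) :=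
    integrableOn_const (hs := measure_Ioc_lt_top.ne)
  have hm : Measurable (Function.uncurry fun (p : E3) (u : ℝ) =>
      Real.sqrt u * Real.exp (-(π ^ 2 * ‖p‖ ^ 2) / u) * Real.cos (2 * π * ⟪p, z⟫_ℝ)) :=
    measurable_tailIntegrand.mul (Real.measurable_cos.comp
      ((continuous_const.mul ((continuous_fst).inner continuous_const)).measurable))
  have hae : ∀ᵐ q : E3 × ℝ ∂(volume.prod (volume.restrict (Ioc 0 T))), q.2 ∈ Ioc 0 T :=
    (Measure.quasiMeasurePreserving_snd).ae (ae_restrict_mem measurableSet_Ioc)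
  refine (hf.mul_prod hg).mono' hm.aestronglyMeasurable (hae.mono fun q hq => ?_)
  obtain ⟨p, u⟩ := q
  simp only [Function.uncurry_apply_pair, mul_one]
  rw [norm_mul, Real.norm_of_nonneg (mul_nonneg (Real.sqrt_nonneg _) (Real.exp_pos _).le)]
  have hq' : u ∈ Ioc 0 T := hq
  calc Real.sqrt u * Real.exp (-(π ^ 2 * ‖p‖ ^ 2) / u) * ‖Real.cos (2 * π * ⟪p, z⟫_ℝ)‖
        ≤ Real.sqrt u * Real.exp (-(π ^ 2 * ‖p‖ ^ 2) / u) * 1 :=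
          mul_le_mul_of_nonneg_left (by rw [Real.norm_eq_abs]; exact Real.abs_cos_le_one _)
            (mul_nonneg (Real.sqrt_nonneg _) (Real.exp_pos _).le)
    _ ≤ Real.sqrt T * Real.exp (-(π ^ 2 / T) * ‖p‖ ^ 2) := by
          rw [mul_one, show -(π ^ 2 / T) * ‖p‖ ^ 2 = -(π ^ 2 * ‖p‖ ^ 2) / T by ring]
          refine mul_le_mul (Real.sqrt_le_sqrt hq'.2) (Real.exp_le_exp.2 ?_) (Real.exp_pos _).le
            (Real.sqrt_nonneg _)
          rw [neg_div, neg_div]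
          exact neg_le_neg (div_le_div_of_nonneg_left (by positivity) hq'.1 hq'.2)

/-- **Fubini for the Bernstein tail**: for `T > 0` and `z ∈ ℝ³`,
`∫ (∫₀ᵀ √u e^{−π²‖p‖²/u} du) cos(2π⟨p, z⟩) dp = (1/√π³) ∫₀ᵀ u² e^{−u‖z‖²} du`. -/
theorem integral_tailKernel_mul_cos (T : ℝ) (hT : 0 < T) (z : E3) :
    ∫ p : E3, (∫ u in (0 : ℝ)..T, Real.sqrt u * Real.exp (-(π ^ 2 * ‖p‖ ^ 2) / u)) *
        Real.cos (2 * π * ⟪p, z⟫_ℝ) =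
      1 / Real.sqrt π ^ 3 * ∫ u in (0 : ℝ)..T, u ^ 2 * Real.exp (-u * ‖z‖ ^ 2) := by
  simp_rw [intervalIntegral.integral_of_le hT.le]
  have e1 : ∀ p : E3, (∫ u in Ioc 0 T, Real.sqrt u * Real.exp (-(π ^ 2 * ‖p‖ ^ 2) / u)) *
      Real.cos (2 * π * ⟪p, z⟫_ℝ) =
      ∫ u in Ioc 0 T, Real.sqrt u * Real.exp (-(π ^ 2 * ‖p‖ ^ 2) / u) *
        Real.cos (2 * π * ⟪p, z⟫_ℝ) := fun p => (integral_mul_const _ _).symm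
  simp_rw [e1]
  rw [integral_integral_swap (integrable_prod_tailIntegrand_mul_cos T hT z),
    ← integral_const_mul]
  refine setIntegral_congr_fun measurableSet_Ioc fun u hu => ?_
  have e2 : (fun p : E3 => Real.sqrt u * Real.exp (-(π ^ 2 * ‖p‖ ^ 2) / u) *
      Real.cos (2 * π * ⟪p, z⟫_ℝ)) = fun p => Real.sqrt u * (Real.exp (-(π ^ 2 * ‖p‖ ^ 2) / u) *
        Real.cos (2 * π * ⟪p, z⟫_ℝ)) := funext fun p => mul_assoc _ _ _
  rw [e2, integral_const_mul, integral_exp_neg_pi_sq_mul_cos u hu.1 z]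
  have e3 : Real.sqrt u * Real.sqrt u ^ 3 = u ^ 2 := by
    rw [← pow_succ', show (3 + 1 : ℕ) = 2 * 2 from rfl, pow_mul, Real.sq_sqrt hu.1.le]
  rw [← e3]
  ring

/-- The Gaussian `p ↦ exp(−π²‖p‖²/t)` (heat parametrisation) is integrable on `ℝ³` for `t > 0`. -/
theorem integrable_exp_neg_pi_sq (t : ℝ) (ht : 0 < t) :
    Integrable fun p : E3 => Real.exp (-(π ^ 2 * ‖p‖ ^ 2) / t) := by
  refine (integrable_exp_neg_mul_sq_norm (π ^ 2 / t) (by positivity)).congr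
    (Filter.Eventually.of_forall fun p => ?_)
  simp only
  rw [show -(π ^ 2 / t) * ‖p‖ ^ 2 = -(π ^ 2 * ‖p‖ ^ 2) / t by ring]

/-- The phase `p ↦ 2π⟨p, z⟩` is continuous. -/
theorem continuous_phase (z : E3) : Continuous fun p : E3 => 2 * π * ⟪p, z⟫_ℝ :=
  continuous_const.mul (continuous_id.inner continuous_const)

/-! ### The Gaussian–Bernstein symbol -/

/-- The Gaussian–Bernstein symbol
`Φ(p) = Σ_m α_m/√(t_m)³ · e^{−π²‖p‖²/t_m} − κ ∫₀ᵀ √u · e^{−π²‖p‖²/u} du` is measurable. -/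
theorem measurable_gaussBernsteinSymbol {M : ℕ} (α t : Fin M → ℝ) (κ T : ℝ) (hT : 0 ≤ T) :
    Measurable fun p : E3 =>
      (∑ m, α m / Real.sqrt (t m) ^ 3 * Real.exp (-(π ^ 2 * ‖p‖ ^ 2) / t m)) -
        κ * ∫ u in (0 : ℝ)..T, Real.sqrt u * Real.exp (-(π ^ 2 * ‖p‖ ^ 2) / u) := by
  refine Measurable.sub (Finset.measurable_sum _ fun m _ => ?_)
    ((stronglyMeasurable_tailKernel T hT).measurable.const_mul κ)
  exact (Real.measurable_exp.comp ((measurable_const.mul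
    (measurable_norm.pow_const 2)).neg.div_const _)).const_mul _

/-- The Gaussian part `Σ_m α_m/√(t_m)³ · e^{−π²‖p‖²/t_m}` of the symbol is integrable. -/
theorem integrable_gaussSymbol {M : ℕ} (α t : Fin M → ℝ) (ht : ∀ m, 0 < t m) :
    Integrable fun p : E3 =>
      ∑ m, α m / Real.sqrt (t m) ^ 3 * Real.exp (-(π ^ 2 * ‖p‖ ^ 2) / t m) :=
  integrable_finsetSum _ fun m _ => (integrable_exp_neg_pi_sq (t m) (ht m)).const_mul _

/-- The Gaussian–Bernstein symbol is integrable (`t_m > 0`, `T > 0`). -/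
theorem integrable_gaussBernsteinSymbol {M : ℕ} (α t : Fin M → ℝ) (ht : ∀ m, 0 < t m) (κ T : ℝ)
    (hT : 0 < T) :
    Integrable fun p : E3 =>
      (∑ m, α m / Real.sqrt (t m) ^ 3 * Real.exp (-(π ^ 2 * ‖p‖ ^ 2) / t m)) -
        κ * ∫ u in (0 : ℝ)..T, Real.sqrt u * Real.exp (-(π ^ 2 * ‖p‖ ^ 2) / u) :=
  (integrable_gaussSymbol α t ht).sub ((integrable_tailKernel T hT).const_mul κ)

/-- **The cosine transform of the Gaussian–Bernstein symbol**: for `t_m > 0`, `T > 0`, `z ∈ ℝ³`,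
`∫ Φ(p) cos(2π⟨p, z⟩) dp = π^{-3/2} (Σ_m α_m e^{−t_m‖z‖²} − κ ∫₀ᵀ u² e^{−u‖z‖²} du)`. -/
theorem integral_gaussBernsteinSymbol_mul_cos {M : ℕ} (α t : Fin M → ℝ) (ht : ∀ m, 0 < t m)
    (κ T : ℝ) (hT : 0 < T) (z : E3) :
    ∫ p : E3, ((∑ m, α m / Real.sqrt (t m) ^ 3 * Real.exp (-(π ^ 2 * ‖p‖ ^ 2) / t m)) -
        κ * ∫ u in (0 : ℝ)..T, Real.sqrt u * Real.exp (-(π ^ 2 * ‖p‖ ^ 2) / u)) *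
        Real.cos (2 * π * ⟪p, z⟫_ℝ) =
      1 / Real.sqrt π ^ 3 * ((∑ m, α m * Real.exp (-(t m) * ‖z‖ ^ 2)) -
        κ * ∫ u in (0 : ℝ)..T, u ^ 2 * Real.exp (-u * ‖z‖ ^ 2)) := by
  -- integrability of the pieces against the cosine
  have hG : ∀ m, Integrable fun p : E3 => Real.exp (-(π ^ 2 * ‖p‖ ^ 2) / t m) *
      Real.cos (2 * π * ⟪p, z⟫_ℝ) := fun m =>
    Coulomb.integrable_mul_cos (integrable_exp_neg_pi_sq (t m) (ht m)) _ (continuous_phase z)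
  have hP : Integrable fun p : E3 => ∑ m, α m / Real.sqrt (t m) ^ 3 *
      (Real.exp (-(π ^ 2 * ‖p‖ ^ 2) / t m) * Real.cos (2 * π * ⟪p, z⟫_ℝ)) :=
    integrable_finsetSum _ fun m _ => (hG m).const_mul _
  have hK : Integrable fun p : E3 => (∫ u in (0 : ℝ)..T, Real.sqrt u *
      Real.exp (-(π ^ 2 * ‖p‖ ^ 2) / u)) * Real.cos (2 * π * ⟪p, z⟫_ℝ) :=
    Coulomb.integrable_mul_cos (integrable_tailKernel T hT) _ (continuous_phase z)
  -- split the integral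
  have e1 : (fun p : E3 =>
      ((∑ m, α m / Real.sqrt (t m) ^ 3 * Real.exp (-(π ^ 2 * ‖p‖ ^ 2) / t m)) -
        κ * ∫ u in (0 : ℝ)..T, Real.sqrt u * Real.exp (-(π ^ 2 * ‖p‖ ^ 2) / u)) *
        Real.cos (2 * π * ⟪p, z⟫_ℝ)) =
      fun p : E3 => (∑ m, α m / Real.sqrt (t m) ^ 3 *
        (Real.exp (-(π ^ 2 * ‖p‖ ^ 2) / t m) * Real.cos (2 * π * ⟪p, z⟫_ℝ))) -
        κ * ((∫ u in (0 : ℝ)..T, Real.sqrt u * Real.exp (-(π ^ 2 * ‖p‖ ^ 2) / u)) *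
          Real.cos (2 * π * ⟪p, z⟫_ℝ)) := by
    funext p
    rw [sub_mul, Finset.sum_mul]
    congr 1
    · exact Finset.sum_congr rfl fun m _ => mul_assoc _ _ _
    · ring
  rw [e1, integral_sub hP (hK.const_mul κ), integral_const_mul, integral_finsetSum _
    (fun m _ => (hG m).const_mul _), integral_tailKernel_mul_cos T hT z, mul_sub, Finset.mul_sum]
  congr 1
  · refine Finset.sum_congr rfl fun m _ => ?_
    rw [integral_const_mul, integral_exp_neg_pi_sq_mul_cos (t m) (ht m) z]
    have h3 : Real.sqrt (t m) ≠ 0 := (Real.sqrt_pos.2 (ht m)).ne'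
    field_simp
  · ring

end PosTypeGaussBernstein

/-- STUB `stub_posType_gaussBernstein` of line `Sketch` (crux stmt-AtomisticToContinuum-11958). -/
theorem stub_posType_gaussBernstein {M : ℕ} (α t : Fin M → ℝ) (ht : ∀ m, 0 < t m) (κ T : ℝ) (hκ : 0 ≤ κ) (hT : 0 < T) (hG : ∀ s : ℝ, 0 ≤ s → κ * ∫ u in (0 : ℝ)..T, Real.sqrt u * Real.exp (-s / u) ≤ ∑ m, α m / Real.sqrt (t m) ^ 3 * Real.exp (-s / t m)) : ∀ (n : ℕ) (y : Fin n → E3) (w : Fin n → ℝ), 0 ≤ ∑ i, ∑ j, w i * w j * ((∑ m, α m * Real.exp (-(t m) * dist (y i) (y j) ^ 2)) - κ * ∫ u in (0 : ℝ)..T, u ^ 2 * Real.exp (-u * dist (y i) (y j) ^ 2)) := by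
  have _ := hκ
  intro n y w
  -- the symbol `Φ ≥ 0` (hypothesis `hG` at `s = π²‖p‖²`)
  have hΦ0 : ∀ p : E3, 0 ≤
      (∑ m, α m / Real.sqrt (t m) ^ 3 * Real.exp (-(Real.pi ^ 2 * ‖p‖ ^ 2) / t m)) -
        κ * ∫ u in (0 : ℝ)..T, Real.sqrt u * Real.exp (-(Real.pi ^ 2 * ‖p‖ ^ 2) / u) :=
    fun p => sub_nonneg.2 (hG (Real.pi ^ 2 * ‖p‖ ^ 2) (by positivity))
  -- the mechanism with background `g := 0`
  have h := Literature.MathematicalPhysics.QuantumManyBody.Coulomb.positiveType_points_nonneg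
    (PosTypeGaussBernstein.measurable_gaussBernsteinSymbol α t κ T hT.le)
    (PosTypeGaussBernstein.integrable_gaussBernsteinSymbol α t ht κ T hT) hΦ0 w y
    (g := fun _ => (0 : ℝ)) measurable_const (integrable_zero _ _ _)
  simp only [zero_mul, integral_zero, mul_zero, Finset.sum_const_zero, sub_zero, add_zero] at h
  -- the kernel of the symbol is `π^{-3/2} ×` the Gaussian–Bernstein function of `dist`
  simp_rw [PosTypeGaussBernstein.integral_gaussBernsteinSymbol_mul_cos α t ht κ T hT,
    ← dist_eq_norm] at h
  have key : ∑ i, ∑ j, w i * w j * (1 / Real.sqrt Real.pi ^ 3 *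
      ((∑ m, α m * Real.exp (-(t m) * dist (y i) (y j) ^ 2)) -
        κ * ∫ u in (0 : ℝ)..T, u ^ 2 * Real.exp (-u * dist (y i) (y j) ^ 2))) =
      1 / Real.sqrt Real.pi ^ 3 * ∑ i, ∑ j, w i * w j *
        ((∑ m, α m * Real.exp (-(t m) * dist (y i) (y j) ^ 2)) -
          κ * ∫ u in (0 : ℝ)..T, u ^ 2 * Real.exp (-u * dist (y i) (y j) ^ 2)) := by
    rw [Finset.mul_sum]
    refine Finset.sum_congr rfl fun i _ => ?_
    rw [Finset.mul_sum]
    refine Finset.sum_congr rfl fun j _ => ?_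
    ring
  rw [key] at h
  exact (mul_nonneg_iff_of_pos_left (by positivity)).1 h

end Summit.AtomisticToContinuum.Crystallization.Theorems
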